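import Summits.QuantumFields.BalabanUV.T4Continuum.Support.NE9CurChartOfBackground
import Literature.MathematicalPhysics.QuantumFieldTheory.Balaban1983to89.B11Eq143LinearTermRadii
import Literature.MathematicalPhysics.QuantumFieldTheory.Balaban1983to89.B11Ineq73KernelLettersPerLattice
import Literature.MathematicalPhysics.QuantumFieldTheory.Balaban1983to89.B11Eq79LinearTerm
import Literature.MathematicalPhysics.QuantumFieldTheory.Balaban1983to89.B11Eq90CurrentAtLetters

/-!
# NE9CurChartOneInstance — THE CHART OF THE CURVE SPECIES `cur U` AS ONE TREE OBJECT: the (L3) letter `W := W80 …` IN THE W-SLOT AT THE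
# T-SLOT's OWN `(H, C, ε_C)` (ONE `ε_C`) AND THE J-79 TERM PLACED IN THE SCHEME's LINEAR SLOT `Λ := −𝔊 ∘L L_J` — the pub-balaban NE9 desk's
# trigger T23 «ONE INSTANCE» (PRICING-NE9 v29/v30) on route R2′ of `t4/ROUTES-NE9.md` («`cur` by B11's displayed contractions»); cell
# `pub-balaban`, T4-DAG §2 node U3 / §6 NE9; NE9 crux-team leaf lineage `b2b-balaban-t4-ne9-formalise-leaf-05`, generation 66; Summits-side NEW
# work under this seat's INTERFACE REQUEST NE9 (ruling e34b3e0c (0)/(2): «post 'INTERFACE REQUEST …' lines for any Support leaf you genuinely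
# need»), nothing printed asserted

HONEST FRAMING (T4-DAG PAGE 1).  Rung (B)+1 of the FINITE-VOLUME T⁴ programme — NOT infinite volume, NOT a mass gap, NOT the Clay problem.  NE9
(`T4OutputRate.NE9` ∧ `FadingMemory`) is a cell NEW ESTIMATE, NOT PRINTED in [I] = [Balaban1987RG1] (CMP **109**), [II] = [Balaban1988RG2Cluster]
(CMP **116**), and NOT PROVED here («NE9 ⇐ the named binders»; spine PROVED 0∕9).  HONEST DEPENDENCY (cell line, verbatim): continuum YM on T⁴ ⇐
BetaPertH ∧ nine spine estimates (0/9 proved); BetaPertH ⇐ (D1) ∧ (D4) ∧ CAP+tail; G-an2-4 gates asym, D1 and NE2/3/4.  The `cur U` OBJECT is ONE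
item of the MODEL O-NE9-1 (species (a) data); the END's `act` / `ker` halves, NEEDS-COORDINATOR #5 and the positivity [Balaban1985BackgroundPropagators]
Thm 3.11 (`hpos`, DISPLAYED by the ABSOLUTE RULE in §3) are untouched.

WHY (the junction this file closes).  The owner's `NE9CurChartOfBackground.cur_chart_exists_of_W_H126` (and its v1.1–v1.2 siblings; v1.3 staged) quantify the
W-slot `{Wq} (hW : QuadAnalytic Wq C₄ a₃)` BEFORE `∃ ε₄ εC Rb R′`, with `Λ := 0`; but the (L3) letter `W80 ρ τ U H C ε_C J Δπ` (this lineage's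
`B11Eq80Current`, [Balaban1985Variational] (80)/(84)–(96)) DEPENDS on the Sect. C radius `ε_C` of the very map (47) `A′ ↦ A′ + solA H 0 C 0 ε_C A′`
that sits in the T-slot — so the one-line feed produces a chart with TWO selection radii (NE9 leaf-06 g56, R-ne9leaf06-g56-1 «ε_C BINDING ORDER»; its
reader scratch (S1d)/(e1)/(g1) composed the re-cut but, under the FREEZE, filed nothing).  And the J-79 cross term `L_J(A′) = −((HC⁽²⁾)′(A′))ᵗJ`
(`B11Eq79LinearTerm.LJ`, linear in `A′`): the chain's `𝔊` (`frakGLatticeCLM` on [Balaban1985BackgroundPropagators] (3.26)) inverts the BARE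
Hessian, so on this road `L_J` must ride in the scheme's LINEAR slot, `Λ := −𝔊 ∘L L_J` — print's own precedent for a kept linear term is
[Balaban1985Variational] (143) p. 300 «A₀ = −G̃J + G̃Δ⁽²⁾(A₀ + H₀B) − G̃((δ∕δA′)V)(A₀ + H₀B) … Proposition 6 is valid for it also» (vs (180) p. 306,
absorbing it into G).  The radii for `Λ ≠ 0` are `B11Eq143LinearTermRadii.exists_regime_radii_linear` (this lineage, gen 66: they exist iff
`‖Λ‖ < 1`); the composite chart is lit-balaban's `chartHB` assembled by `NE9B11ChartAnalytic.chartHB_triple_of_twoRegimes` (E116, generic in `Λ`).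

WHAT THIS FILE PROVES (0 def, 0 sorry, axioms standard).
* §1 **`chart_exists_of_RC_linear`** (generic carriers): for ANY quadratic-analytic `W` analytic on its ball, a Sect. C regime
  `RC : Regime H 0 C b 0 C₂ c₄ 0 a_C ε_C` given as INPUT (with `C` analytic on its ball, `0 < a_C`), ANY linear slot `Λ` with `‖Λ‖ < 1`, `𝒢`, `H₁`:
  `∃ ε₄ R_b R′ > 0`, (Ψ1)–(Ψ3) for `chartHB 𝒢 Λ W 0 (A′ ↦ A′ + solA H 0 C 0 ε_C A′) ε₄ H₁` — the T-slot at THAT `ε_C` (leaf-06's template (S1d),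
  with the linear slot).
* §2 **`chart_exists_W80_LJ`** (the (115) carriers, generic `𝒢`, `H₁`, `H`, `C`): `W := W80 ρ τ U₀ H C ε_C J Δπ` and `Λ := −(𝒢 ∘L LJ ρ τ H C J)` with
  BOTH W-slot binders DISCHARGED per lattice by NE9 leaf-01's `B11Ineq73KernelLettersPerLattice.exists_quadAnalytic_W80`; displayed: `RC`, `Prop4Hyp C`,
  `C` analytic, `0 < a_C`, the V₀-group's slot `hqV` (`‖curV0 Y‖ ≤ C_V‖Y‖²` on `‖Y‖ < R_V`) and the smallness `‖𝒢 ∘L L_J‖ < 1`;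
  `exists_norm_comp_LJ_le` (`∃ K ≥ 0, ∀ J, ‖𝒢 ∘L L_J‖ ≤ K‖J‖₍₋₃₎` — `J ↦ 𝒢 ∘L L_J` is linear on the finite-dimensional current space) and
  **`chart_exists_W80_LJ_smallJ`**: the last display replaced by `∃ j₁ > 0, ∀ J, ‖J‖₍₋₃₎ ≤ j₁ → …` (print: (28) «|J| < C₁B₃ε₁» small).
* §3 **`cur_chart_exists_oneInstance`** — AT THE CHAIN's LETTERS: `𝔊(U) := frakGLatticeCLM …`, `H(U) = H₁(U) := H1LatticeCLM …` (the H126 reading of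
  the owner's `cur_chart_exists_of_W_H126`, «Q onto» by `QtorusW_surjective`), `C(U) := Cc …` with NE9 leaf-03's `prop4Hyp_Cc` ∕ `analyticOnNhd_Cc`,
  E162's background data and the DISPLAYED positivity `hpos`: `∃ a_C ε_C ε₄ R_b R′ > 0`, the Sect. C `Regime` of (47) at `(H(U), C(U), a_C, ε_C)` ∧
  (Ψ1)–(Ψ3) for `chartHB 𝔊(U) (−(𝔊(U) ∘L LJ ρ τ H(U) C(U) J)) (W80 ρ τ U H(U) C(U) ε_C J Δπ) 0 (A′ ↦ A′ + solA H(U) 0 C(U) 0 ε_C A′) ε₄ H(U)` — ONE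
  `ε_C`, the J-term placed; **`cur_chart_exists_oneInstance_smallJ`** (`∃ j₁ > 0, ∀ ‖J‖ ≤ j₁`); **`cur_chart_exists_oneInstance_atLetters`**: the same
  with (G)'s `W80L` (`J := Jcur U`, `Δπ := deltaPiCLM …`) in the W-slot.
DISGUISE TEST: composition of landed theorems (E116 + the owner's letters + leaf-01/03's letters + this lineage's (D)(F)(G) and gen-66 radii); no
inequality of the series proved (radii, `‖𝔊(U)‖`, `‖H(U)‖`, `‖L_J‖`, `C_V` are finite-lattice numbers; uniformity = [B9] Thms 3.12/3.13 + Prop. 4's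
«C₄ depends on d and L only», displayed elsewhere); `hpos` displayed (the owner's v1.2 `cur_chart_exists_flat` ∕ staged v1.3
`cur_chart_exists_of_small_field` show how it is fed); the Λ-road is ONE of T23's two admissible placements — the chain's road (Λ-slot vs a `𝔊` over `Δ₁ := hessOp + Δ_π⁽²⁾(J)`) stays
the OWNER's decision; not NE9.  SEQUEL (same lineage and generation): `NE9CurChartOneInstanceDischarged` — `hqV` replaced by structure (leaf-01's
V₀-letters), `hpos` a theorem at `U = 1`, `G′ := GpOfU` with one trace, and the kernel-road species (`H := HopAd … k_H` in the T-slot).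
References (TYPES ∕ loci only): [Balaban1985Variational] (47) p. 285, (78)–(80) p. 290, (84) p. 290, (85)–(90) p. 291, Prop. 4 (97)–(98) pp. 292–293, Prop. 6
(116)–(121) p. 295, (143) p. 300, (172)–(175) p. 305, (180) p. 306; [Balaban1985BackgroundPropagators] (3.26) p. 395, Thm 3.11 p. 416, (3.126) p. 420.
Imports `NE9CurChartOfBackground` (owner), `B11Eq143LinearTermRadii` (this lineage gen 66), `B11Ineq73KernelLettersPerLattice` (leaf-01),
`B11Eq79LinearTerm` ∕ `B11Eq90CurrentAtLetters` (this lineage gen 65); modifies nothing; no END re-wired.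
Value = the desk's T23 object as a NAMED theorem (route R2′ bookkeeping at rung (B)+1), NOT summit progress.
-/

noncomputable section

open Metric Set

namespace Summit.QuantumFields.BalabanUV.T4Continuum.NE9CurChartOneInstance

open Literature.MathematicalPhysics.QuantumFieldTheory.Balaban1983to89
open B11Eq103H1Complex B11Eq115Space B11Eq174Chart
open B11Eq111FrakG (nabla115)
open B13Contraction113 (QuadAnalytic)
open B11Prop6Scheme (Prop4Hyp)
open B9Eq319QprimeTorus (fineP)
open B9SectCLatticeCarrier (Bond)
open B4Sect5Torus (TSite)
open B7Prop1Explicit (U1 Wcx boxVec)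
open B9Eq315QTorus (perCfg cornerSite QtorusW laplaceAofBackground)
open B9Eq315QTorusOnto (QtorusW_surjective)
open B11Eq118RegimeRadii (exists_regime_radii)
open B11Eq143LinearTermRadii (exists_regime_radii_linear)
open B11Eq44COperatorTorus (Cc analyticOnNhd_Cc prop4Hyp_Cc)
open B11Eq63V0GroupCurrent (curV0)
open B11Eq80Current (W80)
open B11Eq79LinearTerm (LJ)
open B11Eq98CurrentSlot (Jcur)
open B11Eq90CurrentAtLetters (W80L)
open B9Eq3119DeltaPiCarrier (deltaPiCLM)
open B11Ineq73KernelLettersPerLattice (exists_quadAnalytic_W80)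
open Summit.QuantumFields.BalabanUV.T4Continuum.NE9B11ChartAnalytic (chartHB_triple_of_twoRegimes)

/-! ## §1 Generic carriers: the chart at ONE `ε_C` with a linear slot -/

section Generic

variable {𝒴 𝒵 : Type*} [NormedAddCommGroup 𝒴] [NormedSpace ℂ 𝒴] [CompleteSpace 𝒴] [NormedAddCommGroup 𝒵] [NormedSpace ℂ 𝒵]

/-- **THE CHART (174)∘(47) AT ONE `ε_C`, WITH A LINEAR SLOT** (leaf-06's owner-side template (S1d) plus `Λ`): given a Sect. C regime `RC` of the map
(47) at `(H, C, a_C, ε_C)` (INPUT — so a `W` built at that `ε_C` may be fed), `C` analytic on its ball, ANY quadratic-analytic `W` analytic on its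
ball, ANY `Λ` with `‖Λ‖ < 1`, and bounded `𝒢`, `H₁`: there are `ε₄, R_b, R′ > 0` such that lit-balaban's `chartHB 𝒢 Λ W 0 (A′ ↦ A′ + solA H 0 C 0 ε_C A′)
ε₄ H₁` is Fréchet-differentiable on `ball 0 R_b`, maps it into `ball 0 R′` and fixes `0`.  Radii: `B11Eq143LinearTermRadii.exists_regime_radii_linear`
under the cap `a_C`; mechanism: E116 `chartHB_triple_of_twoRegimes`. [folklore] -/
theorem chart_exists_of_RC_linear (𝒢 : 𝒵 →L[ℂ] 𝒴) (Λ : 𝒴 →L[ℂ] 𝒴) (hΛ : ‖Λ‖ < 1) {W : 𝒴 → 𝒵} {C₄ a₃ : ℝ}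
    (hW : QuadAnalytic W C₄ a₃) (hC₄ : 0 ≤ C₄) (ha₃ : 0 < a₃) (hWa : AnalyticOnNhd ℂ W {Y : 𝒴 | ‖Y‖ < a₃})
    {𝒳 : Type*} [NormedAddCommGroup 𝒳] [NormedSpace ℂ 𝒳] {H : 𝒳 →L[ℂ] 𝒴} {C : 𝒴 → 𝒳} {b C₂ c₄ aC εC : ℝ}
    (RC : Regime H 0 C b 0 C₂ c₄ 0 aC εC) (hCa : AnalyticOnNhd ℂ C {Y : 𝒴 | ‖Y‖ < c₄}) (haC : 0 < aC)
    {ℬ : Type*} [NormedAddCommGroup ℬ] [NormedSpace ℂ ℬ] (H₁ : ℬ →L[ℂ] 𝒴) :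
    ∃ ε₄ Rb R' : ℝ, 0 < ε₄ ∧ 0 < Rb ∧ 0 < R' ∧
      DifferentiableOn ℂ (chartHB 𝒢 Λ W 0 (fun A' : 𝒴 => A' + solA H 0 C 0 εC A') ε₄ H₁) (ball (0 : ℬ) Rb) ∧
      MapsTo (chartHB 𝒢 Λ W 0 (fun A' : 𝒴 => A' + solA H 0 C 0 εC A') ε₄ H₁) (ball (0 : ℬ) Rb) (ball (0 : 𝒴) R') ∧
      chartHB 𝒢 Λ W 0 (fun A' : 𝒴 => A' + solA H 0 C 0 εC A') ε₄ H₁ 0 = 0 := by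
  obtain ⟨j₀, a, ε₄, hj₀, ha, hε₄, hcap, hR⟩ := exists_regime_radii_linear 𝒢 Λ hW hC₄ ha₃ hΛ haC
  have R := hR j₀ hj₀.le le_rfl
  have hden : 0 < 1 - 4 * b * C₂ * (εC + aC) := by linarith [RC.contr]
  have hR'0 : 0 < 1 / (1 - 4 * b * C₂ * (εC + aC)) * (ε₄ + a) := by positivity
  have hRb0 : 0 < a / (‖H₁‖ + 1) := by positivity
  have hRb : ∀ B ∈ ball (0 : ℬ) (a / (‖H₁‖ + 1)), ‖H₁ B‖ < a := by
    intro B hB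
    rw [mem_ball_zero_iff] at hB
    have h1 : ‖H₁ B‖ ≤ ‖H₁‖ * ‖B‖ := H₁.le_opNorm B
    have h2 : ‖H₁‖ * ‖B‖ ≤ ‖H₁‖ * (a / (‖H₁‖ + 1)) := mul_le_mul_of_nonneg_left hB.le (norm_nonneg _)
    have h3 : ‖H₁‖ * (a / (‖H₁‖ + 1)) < a := by
      rw [mul_div_assoc', div_lt_iff₀ (by positivity)]; nlinarith [norm_nonneg H₁]
    linarith
  exact ⟨ε₄, _, _, hε₄, hRb0, hR'0, chartHB_triple_of_twoRegimes R hWa hj₀.le ha RC hCa hcap H₁ hRb hR'0 le_rfl⟩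

end Generic

/-! ## §2 The (115) carriers: `W := W80 …` at the T-slot's own `ε_C`, `Λ := −𝒢 ∘L L_J` -/

section W80Generic

variable {𝔸 : Type*} [NormedRing 𝔸] [NormedAlgebra ℂ 𝔸] [FiniteDimensional ℂ 𝔸] [CompleteSpace 𝔸]
variable {d : ℕ} {Pd : Fin d → ℕ} {L η : ℝ} [Fact (0 < L)] [Fact (0 < η)] {lev₀ : Bond d Pd → ℕ} {κ' : Type*} [Fintype κ']
  {lev₁ : κ' → ℕ} {Dc : (Bond d Pd → 𝔸) →ₗ[ℂ] (κ' → 𝔸)}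
variable {𝒳 : Type*} [NormedAddCommGroup 𝒳] [NormedSpace ℂ 𝒳] [CompleteSpace 𝒳]

/-- **THE CHART WITH `W80` IN THE W-SLOT AT THE T-SLOT's OWN `(H, C, ε_C)` AND THE J-79 TERM IN THE LINEAR SLOT** (generic `𝒢`, `H₁`; the (115)
carriers): under the Sect. C regime `RC` at `(H, C, a_C, ε_C)`, `Prop4Hyp C`, `C` analytic, `0 < a_C`, the V₀-group's slot `hqV` and the smallness
`‖𝒢 ∘L L_J‖ < 1` of the linear term: `∃ ε₄ R_b R′ > 0`, (Ψ1)–(Ψ3) for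
`chartHB 𝒢 (−(𝒢 ∘L LJ ρ τ H C J)) (W80 ρ τ U₀ H C ε_C J Δπ) 0 (A′ ↦ A′ + solA H 0 C 0 ε_C A′) ε₄ H₁` — BOTH W-slot binders of `W80` DISCHARGED per
lattice by NE9 leaf-01's `exists_quadAnalytic_W80` (its `C₄`, `R′` are finite-lattice numbers). [folklore] -/
theorem chart_exists_W80_LJ (𝒢 : NegSize L η lev₀ 3 𝔸 →L[ℂ] Space115 L η lev₀ lev₁ Dc)
    (ρ : (𝔸 →L[ℂ] ℂ) →L[ℂ] 𝔸) (τ : 𝔸 →L[ℂ] ℂ) (U₀ : Bond d Pd → 𝔸ˣ) {CV RV : ℝ} (hCV : 0 ≤ CV) (hRV : 0 < RV)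
    (hqV : ∀ Y : Space115 L η lev₀ lev₁ Dc, ‖Y‖ < RV → ‖curV0 (lev₁ := lev₁) (Dc := Dc) ρ τ U₀ Y‖ ≤ CV * ‖Y‖ ^ 2)
    {H : 𝒳 →L[ℂ] Space115 L η lev₀ lev₁ Dc} {C : Space115 L η lev₀ lev₁ Dc → 𝒳} {b C₂ c₄ aC εC : ℝ}
    (RC : Regime H 0 C b 0 C₂ c₄ 0 aC εC) (hC : Prop4Hyp C C₂ c₄)
    (hCa : AnalyticOnNhd ℂ C {Y : Space115 L η lev₀ lev₁ Dc | ‖Y‖ < c₄}) (haC : 0 < aC)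
    (J : NegSize L η lev₀ 3 𝔸) (Δπ : Space115 L η lev₀ lev₁ Dc →L[ℂ] NegSize L η lev₀ 3 𝔸)
    (hθ : ‖𝒢.comp (LJ ρ τ H C J)‖ < 1)
    {ℬ : Type*} [NormedAddCommGroup ℬ] [NormedSpace ℂ ℬ] (H₁ : ℬ →L[ℂ] Space115 L η lev₀ lev₁ Dc) :
    ∃ ε₄ Rb R' : ℝ, 0 < ε₄ ∧ 0 < Rb ∧ 0 < R' ∧
      DifferentiableOn ℂ (chartHB 𝒢 (-(𝒢.comp (LJ ρ τ H C J))) (W80 ρ τ U₀ H C εC J Δπ) 0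
          (fun A' => A' + solA H 0 C 0 εC A') ε₄ H₁) (ball (0 : ℬ) Rb) ∧
      MapsTo (chartHB 𝒢 (-(𝒢.comp (LJ ρ τ H C J))) (W80 ρ τ U₀ H C εC J Δπ) 0
          (fun A' => A' + solA H 0 C 0 εC A') ε₄ H₁) (ball (0 : ℬ) Rb) (ball (0 : Space115 L η lev₀ lev₁ Dc) R') ∧
      chartHB 𝒢 (-(𝒢.comp (LJ ρ τ H C J))) (W80 ρ τ U₀ H C εC J Δπ) 0
          (fun A' => A' + solA H 0 C 0 εC A') ε₄ H₁ 0 = 0 := by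
  obtain ⟨R', hR'0, C₄, hC₄, hW, hWa⟩ := exists_quadAnalytic_W80 ρ τ U₀ hCV hRV hqV RC hC haC J Δπ
  have hΛ : ‖-(𝒢.comp (LJ ρ τ H C J))‖ < 1 := by rwa [norm_neg]
  exact chart_exists_of_RC_linear 𝒢 _ hΛ hW hC₄ hR'0 hWa RC hCa haC H₁

omit [CompleteSpace 𝔸] [CompleteSpace 𝒳] in
/-- **THE LINEAR SLOT IS O(‖J‖₍₋₃₎) PER LATTICE**: `∃ K ≥ 0, ∀ J, ‖𝒢 ∘L L_J‖ ≤ K·‖J‖₍₋₃₎` — `J ↦ 𝒢 ∘L LJ ρ τ H C J` is a LINEAR map out of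
the finite-dimensional current space `NegSize … 3 𝔸` (`L_J = −(ev_J) ∘L (transCurL ρ τ) ∘L (compL H) ∘L (dQuad C)`, `B11Eq79LinearTerm.LJ`), hence
bounded; `K` is a finite-lattice number (print: the column letter θ₂ of (46) + locality of `C⁽²⁾`, uniform — NOT reproduced).
[cite: Balaban1985Variational, (79) p.290, (28) p.282] -/
theorem exists_norm_comp_LJ_le (𝒢 : NegSize L η lev₀ 3 𝔸 →L[ℂ] Space115 L η lev₀ lev₁ Dc) (ρ : (𝔸 →L[ℂ] ℂ) →L[ℂ] 𝔸)
    (τ : 𝔸 →L[ℂ] ℂ) (H : 𝒳 →L[ℂ] Space115 L η lev₀ lev₁ Dc) (C : Space115 L η lev₀ lev₁ Dc → 𝒳) :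
    ∃ K : ℝ, 0 ≤ K ∧ ∀ J : NegSize L η lev₀ 3 𝔸, ‖𝒢.comp (LJ ρ τ H C J)‖ ≤ K * ‖J‖ := by
  -- the linear map `J ↦ 𝒢 ∘L L_J` on the finite-dimensional current space, made continuous
  let Φ : NegSize L η lev₀ 3 𝔸 →ₗ[ℂ] (Space115 L η lev₀ lev₁ Dc →L[ℂ] Space115 L η lev₀ lev₁ Dc) :=
    { toFun := fun J => 𝒢.comp (LJ ρ τ H C J)
      map_add' := fun J₁ J₂ => by
        simp only [LJ, map_add, ContinuousLinearMap.add_comp, neg_add, ContinuousLinearMap.comp_add]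
      map_smul' := fun c J => by
        simp only [LJ, map_smul, ContinuousLinearMap.smul_comp, ContinuousLinearMap.comp_neg,
          ContinuousLinearMap.comp_smul, smul_neg, RingHom.id_apply] }
  -- finite-dimensional domain ⇒ continuous ⇒ bounded (no operator norm of the nested map is named)
  obtain ⟨K, hK0, hK⟩ := (LinearMap.toContinuousLinearMap Φ).bound
  exact ⟨K, hK0.le, fun J => hK J⟩

/-- **THE SAME FOR ALL SMALL CURRENTS**: `∃ j₁ > 0` (a finite-lattice number depending on the given `𝒢`, `H`, `C` — at the chain's letters: on the
lattice AND on the background `U`: `1/(2(K + 1))` with `K` of `exists_norm_comp_LJ_le`) such that for EVERY current letter `J` with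
`‖J‖₍₋₃₎ ≤ j₁` the chart with `W80 … J Δπ` in the W-slot and `Λ := −(𝒢 ∘L L_J)` satisfies (Ψ1)–(Ψ3) on some balls — the smallness display
`‖𝒢 ∘L L_J‖ < 1` of `chart_exists_W80_LJ` DISCHARGED to print's «|J| < C₁B₃ε₁» ((28)) read as «J small» (`exists_norm_comp_LJ_le`). [folklore] -/
theorem chart_exists_W80_LJ_smallJ (𝒢 : NegSize L η lev₀ 3 𝔸 →L[ℂ] Space115 L η lev₀ lev₁ Dc)
    (ρ : (𝔸 →L[ℂ] ℂ) →L[ℂ] 𝔸) (τ : 𝔸 →L[ℂ] ℂ) (U₀ : Bond d Pd → 𝔸ˣ) {CV RV : ℝ} (hCV : 0 ≤ CV) (hRV : 0 < RV)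
    (hqV : ∀ Y : Space115 L η lev₀ lev₁ Dc, ‖Y‖ < RV → ‖curV0 (lev₁ := lev₁) (Dc := Dc) ρ τ U₀ Y‖ ≤ CV * ‖Y‖ ^ 2)
    {H : 𝒳 →L[ℂ] Space115 L η lev₀ lev₁ Dc} {C : Space115 L η lev₀ lev₁ Dc → 𝒳} {b C₂ c₄ aC εC : ℝ}
    (RC : Regime H 0 C b 0 C₂ c₄ 0 aC εC) (hC : Prop4Hyp C C₂ c₄)
    (hCa : AnalyticOnNhd ℂ C {Y : Space115 L η lev₀ lev₁ Dc | ‖Y‖ < c₄}) (haC : 0 < aC)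
    (Δπ : Space115 L η lev₀ lev₁ Dc →L[ℂ] NegSize L η lev₀ 3 𝔸)
    {ℬ : Type*} [NormedAddCommGroup ℬ] [NormedSpace ℂ ℬ] (H₁ : ℬ →L[ℂ] Space115 L η lev₀ lev₁ Dc) :
    ∃ j₁ : ℝ, 0 < j₁ ∧ ∀ J : NegSize L η lev₀ 3 𝔸, ‖J‖ ≤ j₁ →
      ∃ ε₄ Rb R' : ℝ, 0 < ε₄ ∧ 0 < Rb ∧ 0 < R' ∧
        DifferentiableOn ℂ (chartHB 𝒢 (-(𝒢.comp (LJ ρ τ H C J))) (W80 ρ τ U₀ H C εC J Δπ) 0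
            (fun A' => A' + solA H 0 C 0 εC A') ε₄ H₁) (ball (0 : ℬ) Rb) ∧
        MapsTo (chartHB 𝒢 (-(𝒢.comp (LJ ρ τ H C J))) (W80 ρ τ U₀ H C εC J Δπ) 0
            (fun A' => A' + solA H 0 C 0 εC A') ε₄ H₁) (ball (0 : ℬ) Rb) (ball (0 : Space115 L η lev₀ lev₁ Dc) R') ∧
        chartHB 𝒢 (-(𝒢.comp (LJ ρ τ H C J))) (W80 ρ τ U₀ H C εC J Δπ) 0
            (fun A' => A' + solA H 0 C 0 εC A') ε₄ H₁ 0 = 0 := by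
  obtain ⟨K, hK0, hK⟩ := exists_norm_comp_LJ_le 𝒢 ρ τ H C
  refine ⟨1 / (2 * (K + 1)), by positivity, fun J hJ => ?_⟩
  have hθ : ‖𝒢.comp (LJ ρ τ H C J)‖ < 1 := by
    have h1 : ‖𝒢.comp (LJ ρ τ H C J)‖ ≤ K * ‖J‖ := hK J
    have h2 : K * ‖J‖ ≤ K * (1 / (2 * (K + 1))) := mul_le_mul_of_nonneg_left hJ hK0
    have h3 : K * (1 / (2 * (K + 1))) < 1 := by
      rw [mul_one_div, div_lt_one (by positivity)]; linarith
    linarith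
  exact chart_exists_W80_LJ 𝒢 ρ τ U₀ hCV hRV hqV RC hC hCa haC J Δπ hθ H₁

end W80Generic

/-! ## §3 AT THE CHAIN's LETTERS: the desk's T23 object -/

section Chain

set_option maxRecDepth 8192 in
/-- **THE CHART OF `cur U` AS ONE TREE OBJECT — `W80` IN THE W-SLOT AT THE T-SLOT's OWN `(H(U), C(U), ε_C)`, THE J-79 TERM IN THE LINEAR SLOT**:
for a background `U` on the torus `T_{L·m}` with E162's displayed data, the fibre/trace readings, weights `c₀, c₁ > 0`, `a`, the DISPLAYED positivity
`hpos` of the assembled `Δ_a(U)` ([Balaban1985BackgroundPropagators] Thm 3.11, ABSOLUTE RULE), level maps with `1 ≤ lev₀`, the (L3) letters `ρ`, `τ`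
(continuous trace), `J`, `Δπ` of `W80`, the V₀-group's slot `hqV`, and — with `H(U) := H1LatticeCLM …`, `𝔊(U) := frakGLatticeCLM …`,
`C(U) := Cc …` — the smallness `‖𝔊(U) ∘L L_J‖ < 1` of the J-79 linear term: THERE ARE `a_C ε_C ε₄ R_b R′ > 0` such that (i) the Sect. C regime of
the map (47) holds at `(H(U), C(U), a_C, ε_C)` (leaf-03's constants `C₂ = 2097152(d+1)²`, `c₄ = 1∕(512(d+1))`), and (ii) lit-balaban's chart
`chartHB 𝔊(U) (−(𝔊(U) ∘L LJ ρ τ H(U) C(U) J)) (W80 ρ τ U H(U) C(U) ε_C J Δπ) 0 (A′ ↦ A′ + solA H(U) 0 C(U) 0 ε_C A′) ε₄ H(U)` is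
Fréchet-differentiable on `ball 0 R_b`, maps it into `ball 0 R′` and fixes `0` — the SAME `ε_C` in the W-slot and in the T-slot.  Two trace letters
appear: `τ : 𝔸 →ₗ[ℂ] ℂ` norms the Hessian ∕ `hpos` (the owner's letter) and `τc : 𝔸 →L[ℂ] ℂ` builds the `ρ`-currents of `W80`; print has ONE `tr` —
a consumer identifies them by `τc := LinearMap.toContinuousLinearMap τ` (finite-dimensional `𝔸`).  `hpos` is fed by
the owner's `laplaceAofBackground_one_pos` (U = 1) ∕ `…_pos_of_small_field` (v1.3); the W-slot binders by leaf-01's `exists_quadAnalytic_W80`. [folklore] -/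
theorem cur_chart_exists_oneInstance {d : ℕ} (L : ℕ) [NeZero L] (m : Fin d → ℕ) [∀ i, NeZero (fineP L m i)] (hL : 1 ≤ L)
    {𝔸 : Type*} [NormedRing 𝔸] [NormedAlgebra ℂ 𝔸] [CompleteSpace 𝔸] [NormOneClass 𝔸] [StarRing 𝔸] [StarModule ℂ 𝔸] [FiniteDimensional ℂ 𝔸]
    {W : Type*} [NormedAddCommGroup W] [InnerProductSpace ℂ W] [FiniteDimensional ℂ W] (φ : W ≃ₗ[ℂ] 𝔸) (τ : 𝔸 →ₗ[ℂ] ℂ)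
    {η : ℝ} [Fact (0 < (L : ℝ))] [Fact (0 < η)] {lev₀ : Bond d (fineP L m) → ℕ} {levB : Bond d m → ℕ} (lev₁ : Bond d (fineP L m) × Fin d → ℕ)
    (hlev : ∀ b, 1 ≤ lev₀ b)
    (U : Bond d (fineP L m) → 𝔸ˣ) {α : ℝ} (hα : α ≤ 1 / 128) (hα1 : α ≤ 1 / 64)
    (hU1 : ∀ (x : B7Prop1Explicit.Site d) (κ : Fin d), perCfg (fineP L m) U x κ ∈ U1 𝔸)
    (hreg : ∀ (y : TSite d m) (κ : Fin d) (r : Fin d → Fin L),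
      ‖((Wcx L (perCfg (fineP L m) U) (cornerSite L y) κ (boxVec L r) : 𝔸ˣ) : 𝔸) - 1‖ ≤ α)
    (hαL : 50 * (d + 1) * α * (L : ℝ) ^ d ≤ 1 / 2)
    {c₀ c₁ : ℝ} [Fact (0 < c₀)] [Fact (0 < c₁)] (a : ℝ)
    (hpos : ∀ x : BondL2K ℂ d (fineP L m) c₀ W, x ≠ 0 →
      0 < RCLike.re (inner ℂ x (laplaceAofBackground L m hL φ U hα1 hU1 hreg τ η (c₀ := c₀) (c₁ := c₁) a x)))
    -- the (L3) letters of `W80` and the V₀-group's slot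
    (ρ : (𝔸 →L[ℂ] ℂ) →L[ℂ] 𝔸) (τc : 𝔸 →L[ℂ] ℂ) {CV RV : ℝ} (hCV : 0 ≤ CV) (hRV : 0 < RV)
    (hqV : ∀ Y : Space115 (L : ℝ) η lev₀ lev₁ (nabla115 η U), ‖Y‖ < RV →
      ‖curV0 (lev₁ := lev₁) (Dc := nabla115 η U) ρ τc U Y‖ ≤ CV * ‖Y‖ ^ 2)
    (J : NegSize (L : ℝ) η lev₀ 3 𝔸) (Δπ : Space115 (L : ℝ) η lev₀ lev₁ (nabla115 η U) →L[ℂ] NegSize (L : ℝ) η lev₀ 3 𝔸) :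
    let Hc := H1LatticeCLM (lev₀ := lev₀) (levB := levB) φ hpos (QtorusW_surjective L m hL U hα1 hU1 hreg hαL φ) lev₁ (nabla115 η U)
    let Gc := frakGLatticeCLM (lev₀ := lev₀) φ hpos (QtorusW_surjective L m hL U hα1 hU1 hreg hαL φ) lev₁ (nabla115 η U)
    let Cx := Cc L m η U lev₀ lev₁ (nabla115 η U) levB
    ‖Gc.comp (LJ ρ τc Hc Cx J)‖ < 1 →
    ∃ aC εC ε₄ Rb R' : ℝ, 0 < aC ∧ 0 < εC ∧ 0 < ε₄ ∧ 0 < Rb ∧ 0 < R' ∧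
      Regime Hc 0 Cx ‖Hc‖ 0 (2097152 * ((d : ℝ) + 1) ^ 2) (1 / (512 * ((d : ℝ) + 1))) 0 aC εC ∧
      DifferentiableOn ℂ (chartHB Gc (-(Gc.comp (LJ ρ τc Hc Cx J))) (W80 ρ τc U Hc Cx εC J Δπ) 0
          (fun A' => A' + solA Hc 0 Cx 0 εC A') ε₄ Hc) (ball (0 : NegSize (L : ℝ) η levB 0 𝔸) Rb) ∧
      MapsTo (chartHB Gc (-(Gc.comp (LJ ρ τc Hc Cx J))) (W80 ρ τc U Hc Cx εC J Δπ) 0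
          (fun A' => A' + solA Hc 0 Cx 0 εC A') ε₄ Hc) (ball (0 : NegSize (L : ℝ) η levB 0 𝔸) Rb)
          (ball (0 : Space115 (L : ℝ) η lev₀ lev₁ (nabla115 η U)) R') ∧
      chartHB Gc (-(Gc.comp (LJ ρ τc Hc Cx J))) (W80 ρ τc U Hc Cx εC J Δπ) 0
          (fun A' => A' + solA Hc 0 Cx 0 εC A') ε₄ Hc 0 = 0 := by
  intro Hc Gc Cx hθ
  -- Sect. C radii FIRST (W-independent), at leaf-03's letters
  have hC : Prop4Hyp Cx (2097152 * ((d : ℝ) + 1) ^ 2) (1 / (512 * ((d : ℝ) + 1))) :=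
    prop4Hyp_Cc L m η U lev₀ lev₁ (nabla115 η U) levB hL hα hU1 hreg hlev
  have hCa : AnalyticOnNhd ℂ Cx {Y | ‖Y‖ < 1 / (512 * ((d : ℝ) + 1))} :=
    analyticOnNhd_Cc L m η U lev₀ lev₁ (nabla115 η U) levB hL hα hU1 hreg hlev
  obtain ⟨j₁, aC, εC, hj₁, haC, hεC, -, hRC⟩ := exists_regime_radii Hc hC.quadAnalytic (by positivity) (by positivity) one_pos
  have RC : Regime Hc 0 Cx ‖Hc‖ 0 (2097152 * ((d : ℝ) + 1) ^ 2) (1 / (512 * ((d : ℝ) + 1))) 0 aC εC := hRC 0 le_rfl hj₁.le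
  -- THEN `W := W80 … εC …` at THAT `εC`, and the linear slot
  obtain ⟨ε₄, Rb, R', hε₄, hRb, hR', htriple⟩ := chart_exists_W80_LJ Gc ρ τc U hCV hRV hqV RC hC hCa haC J Δπ hθ Hc
  exact ⟨aC, εC, ε₄, Rb, R', haC, hεC, hε₄, hRb, hR', RC, htriple⟩

set_option maxRecDepth 8192 in
/-- **THE SAME FOR ALL SMALL CURRENTS `J`** — the smallness display `‖𝔊(U) ∘L L_J‖ < 1` DISCHARGED to «`‖J‖₍₋₃₎ ≤ j₁`» with a finite-lattice,
BACKGROUND-DEPENDENT threshold `j₁ > 0` (`exists_norm_comp_LJ_le` at the chain's letters `𝔊(U)`, `H(U)`, `C(U)`; uniform over the small-field set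
only with uniform letters for `‖𝔊(U)‖`, `‖H(U)‖`, `‖L_J‖` — displayed elsewhere; print: (28) «|J| < C₁B₃ε₁» with ε₁ small): for EVERY current letter `J` with
`‖J‖ ≤ j₁` and every `Δπ`, the one-instance chart of `cur U` with `W80 … ε_C J Δπ` in the W-slot and `Λ := −(𝔊(U) ∘L L_J)` exists as in
`cur_chart_exists_oneInstance`. [folklore] -/
theorem cur_chart_exists_oneInstance_smallJ {d : ℕ} (L : ℕ) [NeZero L] (m : Fin d → ℕ) [∀ i, NeZero (fineP L m i)] (hL : 1 ≤ L)
    {𝔸 : Type*} [NormedRing 𝔸] [NormedAlgebra ℂ 𝔸] [CompleteSpace 𝔸] [NormOneClass 𝔸] [StarRing 𝔸] [StarModule ℂ 𝔸] [FiniteDimensional ℂ 𝔸]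
    {W : Type*} [NormedAddCommGroup W] [InnerProductSpace ℂ W] [FiniteDimensional ℂ W] (φ : W ≃ₗ[ℂ] 𝔸) (τ : 𝔸 →ₗ[ℂ] ℂ)
    {η : ℝ} [Fact (0 < (L : ℝ))] [Fact (0 < η)] {lev₀ : Bond d (fineP L m) → ℕ} {levB : Bond d m → ℕ} (lev₁ : Bond d (fineP L m) × Fin d → ℕ)
    (hlev : ∀ b, 1 ≤ lev₀ b)
    (U : Bond d (fineP L m) → 𝔸ˣ) {α : ℝ} (hα : α ≤ 1 / 128) (hα1 : α ≤ 1 / 64)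
    (hU1 : ∀ (x : B7Prop1Explicit.Site d) (κ : Fin d), perCfg (fineP L m) U x κ ∈ U1 𝔸)
    (hreg : ∀ (y : TSite d m) (κ : Fin d) (r : Fin d → Fin L),
      ‖((Wcx L (perCfg (fineP L m) U) (cornerSite L y) κ (boxVec L r) : 𝔸ˣ) : 𝔸) - 1‖ ≤ α)
    (hαL : 50 * (d + 1) * α * (L : ℝ) ^ d ≤ 1 / 2)
    {c₀ c₁ : ℝ} [Fact (0 < c₀)] [Fact (0 < c₁)] (a : ℝ)
    (hpos : ∀ x : BondL2K ℂ d (fineP L m) c₀ W, x ≠ 0 →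
      0 < RCLike.re (inner ℂ x (laplaceAofBackground L m hL φ U hα1 hU1 hreg τ η (c₀ := c₀) (c₁ := c₁) a x)))
    -- the (L3) letters of `W80` and the V₀-group's slot
    (ρ : (𝔸 →L[ℂ] ℂ) →L[ℂ] 𝔸) (τc : 𝔸 →L[ℂ] ℂ) {CV RV : ℝ} (hCV : 0 ≤ CV) (hRV : 0 < RV)
    (hqV : ∀ Y : Space115 (L : ℝ) η lev₀ lev₁ (nabla115 η U), ‖Y‖ < RV →
      ‖curV0 (lev₁ := lev₁) (Dc := nabla115 η U) ρ τc U Y‖ ≤ CV * ‖Y‖ ^ 2) :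
    let Hc := H1LatticeCLM (lev₀ := lev₀) (levB := levB) φ hpos (QtorusW_surjective L m hL U hα1 hU1 hreg hαL φ) lev₁ (nabla115 η U)
    let Gc := frakGLatticeCLM (lev₀ := lev₀) φ hpos (QtorusW_surjective L m hL U hα1 hU1 hreg hαL φ) lev₁ (nabla115 η U)
    let Cx := Cc L m η U lev₀ lev₁ (nabla115 η U) levB
    ∃ j₁ : ℝ, 0 < j₁ ∧ ∀ (J : NegSize (L : ℝ) η lev₀ 3 𝔸)
      (Δπ : Space115 (L : ℝ) η lev₀ lev₁ (nabla115 η U) →L[ℂ] NegSize (L : ℝ) η lev₀ 3 𝔸), ‖J‖ ≤ j₁ →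
      ∃ aC εC ε₄ Rb R' : ℝ, 0 < aC ∧ 0 < εC ∧ 0 < ε₄ ∧ 0 < Rb ∧ 0 < R' ∧
        Regime Hc 0 Cx ‖Hc‖ 0 (2097152 * ((d : ℝ) + 1) ^ 2) (1 / (512 * ((d : ℝ) + 1))) 0 aC εC ∧
        DifferentiableOn ℂ (chartHB Gc (-(Gc.comp (LJ ρ τc Hc Cx J))) (W80 ρ τc U Hc Cx εC J Δπ) 0
            (fun A' => A' + solA Hc 0 Cx 0 εC A') ε₄ Hc) (ball (0 : NegSize (L : ℝ) η levB 0 𝔸) Rb) ∧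
        MapsTo (chartHB Gc (-(Gc.comp (LJ ρ τc Hc Cx J))) (W80 ρ τc U Hc Cx εC J Δπ) 0
            (fun A' => A' + solA Hc 0 Cx 0 εC A') ε₄ Hc) (ball (0 : NegSize (L : ℝ) η levB 0 𝔸) Rb)
            (ball (0 : Space115 (L : ℝ) η lev₀ lev₁ (nabla115 η U)) R') ∧
        chartHB Gc (-(Gc.comp (LJ ρ τc Hc Cx J))) (W80 ρ τc U Hc Cx εC J Δπ) 0
            (fun A' => A' + solA Hc 0 Cx 0 εC A') ε₄ Hc 0 = 0 := by
  intro Hc Gc Cx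
  obtain ⟨K, hK0, hK⟩ := exists_norm_comp_LJ_le Gc ρ τc Hc Cx
  refine ⟨1 / (2 * (K + 1)), by positivity, fun J Δπ hJ => ?_⟩
  have hθ : ‖Gc.comp (LJ ρ τc Hc Cx J)‖ < 1 := by
    have h1 : ‖Gc.comp (LJ ρ τc Hc Cx J)‖ ≤ K * ‖J‖ := hK J
    have h2 : K * ‖J‖ ≤ K * (1 / (2 * (K + 1))) := mul_le_mul_of_nonneg_left hJ hK0
    have h3 : K * (1 / (2 * (K + 1))) < 1 := by
      rw [mul_one_div, div_lt_one (by positivity)]; linarith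
    linarith
  exact cur_chart_exists_oneInstance L m hL φ τ lev₁ hlev U hα hα1 hU1 hreg hαL a hpos ρ τc hCV hRV hqV J Δπ hθ

set_option maxRecDepth 8192 in
/-- **THE SAME WITH (G)'s `W80L` IN THE W-SLOT** — BOTH operator letters of `W` INSTANTIATED: `J := Jcur U` (r08's current (27)∕(28) in the carrier,
`B11Eq98CurrentSlot.Jcur`) and `Δπ := deltaPiCLM L m φ τ U G′ lev₁ (nabla115 η U)` (NE9 leaf-01's [Balaban1985BackgroundPropagators] (3.119) at the
carrier, MODULO its Green's-function letter `G′ : SiteL2K →ₗ SiteL2K`, kept FREE here — inhabited in the tree by `B9Eq3119DeltaPiCarrier.GpOfU`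
with NE9 leaf-02's `B9Thm311DeltaPrimeA.laplacePrimeA_pos` discharging its positivity); the linear slot is `Λ := −(𝔊(U) ∘L L_{Jcur U})`.
`W80L … = W80 … (Jcur U) (deltaPiCLM …)` by `rfl`. [folklore] -/
theorem cur_chart_exists_oneInstance_atLetters {d : ℕ} (L : ℕ) [NeZero L] (m : Fin d → ℕ) [∀ i, NeZero (fineP L m i)] (hL : 1 ≤ L)
    {𝔸 : Type*} [NormedRing 𝔸] [NormedAlgebra ℂ 𝔸] [CompleteSpace 𝔸] [NormOneClass 𝔸] [StarRing 𝔸] [StarModule ℂ 𝔸] [FiniteDimensional ℂ 𝔸]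
    {W : Type*} [NormedAddCommGroup W] [InnerProductSpace ℂ W] [FiniteDimensional ℂ W] (φ : W ≃ₗ[ℂ] 𝔸) (τ : 𝔸 →ₗ[ℂ] ℂ)
    {η : ℝ} [Fact (0 < (L : ℝ))] [Fact (0 < η)] {lev₀ : Bond d (fineP L m) → ℕ} {levB : Bond d m → ℕ} (lev₁ : Bond d (fineP L m) × Fin d → ℕ)
    (hlev : ∀ b, 1 ≤ lev₀ b)
    (U : Bond d (fineP L m) → 𝔸ˣ) {α : ℝ} (hα : α ≤ 1 / 128) (hα1 : α ≤ 1 / 64)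
    (hU1 : ∀ (x : B7Prop1Explicit.Site d) (κ : Fin d), perCfg (fineP L m) U x κ ∈ U1 𝔸)
    (hreg : ∀ (y : TSite d m) (κ : Fin d) (r : Fin d → Fin L),
      ‖((Wcx L (perCfg (fineP L m) U) (cornerSite L y) κ (boxVec L r) : 𝔸ˣ) : 𝔸) - 1‖ ≤ α)
    (hαL : 50 * (d + 1) * α * (L : ℝ) ^ d ≤ 1 / 2)
    {c₀ c₁ : ℝ} [Fact (0 < c₀)] [Fact (0 < c₁)] (a : ℝ)
    (hpos : ∀ x : BondL2K ℂ d (fineP L m) c₀ W, x ≠ 0 →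
      0 < RCLike.re (inner ℂ x (laplaceAofBackground L m hL φ U hα1 hU1 hreg τ η (c₀ := c₀) (c₁ := c₁) a x)))
    -- the (L3) letters of `W80` and the V₀-group's slot
    (ρ : (𝔸 →L[ℂ] ℂ) →L[ℂ] 𝔸) (τc : 𝔸 →L[ℂ] ℂ) {CV RV : ℝ} (hCV : 0 ≤ CV) (hRV : 0 < RV)
    (hqV : ∀ Y : Space115 (L : ℝ) η lev₀ lev₁ (nabla115 η U), ‖Y‖ < RV →
      ‖curV0 (lev₁ := lev₁) (Dc := nabla115 η U) ρ τc U Y‖ ≤ CV * ‖Y‖ ^ 2)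
    (Gp : SiteL2K ℂ d (fineP L m) c₀ W →ₗ[ℂ] SiteL2K ℂ d (fineP L m) c₀ W) :
    let Hc := H1LatticeCLM (lev₀ := lev₀) (levB := levB) φ hpos (QtorusW_surjective L m hL U hα1 hU1 hreg hαL φ) lev₁ (nabla115 η U)
    let Gc := frakGLatticeCLM (lev₀ := lev₀) φ hpos (QtorusW_surjective L m hL U hα1 hU1 hreg hαL φ) lev₁ (nabla115 η U)
    let Cx := Cc L m η U lev₀ lev₁ (nabla115 η U) levB
    ‖Gc.comp (LJ ρ τc Hc Cx (Jcur (L := (L : ℝ)) (η := η) (lev₀ := lev₀) U))‖ < 1 →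
    ∃ aC εC ε₄ Rb R' : ℝ, 0 < aC ∧ 0 < εC ∧ 0 < ε₄ ∧ 0 < Rb ∧ 0 < R' ∧
      Regime Hc 0 Cx ‖Hc‖ 0 (2097152 * ((d : ℝ) + 1) ^ 2) (1 / (512 * ((d : ℝ) + 1))) 0 aC εC ∧
      DifferentiableOn ℂ (chartHB Gc (-(Gc.comp (LJ ρ τc Hc Cx (Jcur (L := (L : ℝ)) (η := η) (lev₀ := lev₀) U)))) (W80L L m φ U Gp lev₁ (nabla115 η U) ρ τc Hc Cx εC) 0
          (fun A' => A' + solA Hc 0 Cx 0 εC A') ε₄ Hc) (ball (0 : NegSize (L : ℝ) η levB 0 𝔸) Rb) ∧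
      MapsTo (chartHB Gc (-(Gc.comp (LJ ρ τc Hc Cx (Jcur (L := (L : ℝ)) (η := η) (lev₀ := lev₀) U)))) (W80L L m φ U Gp lev₁ (nabla115 η U) ρ τc Hc Cx εC) 0
          (fun A' => A' + solA Hc 0 Cx 0 εC A') ε₄ Hc) (ball (0 : NegSize (L : ℝ) η levB 0 𝔸) Rb)
          (ball (0 : Space115 (L : ℝ) η lev₀ lev₁ (nabla115 η U)) R') ∧
      chartHB Gc (-(Gc.comp (LJ ρ τc Hc Cx (Jcur (L := (L : ℝ)) (η := η) (lev₀ := lev₀) U)))) (W80L L m φ U Gp lev₁ (nabla115 η U) ρ τc Hc Cx εC) 0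
          (fun A' => A' + solA Hc 0 Cx 0 εC A') ε₄ Hc 0 = 0 := by
  intro Hc Gc Cx hθ
  exact cur_chart_exists_oneInstance L m hL φ τ lev₁ hlev U hα hα1 hU1 hreg hαL a hpos ρ τc hCV hRV hqV
    (Jcur (L := (L : ℝ)) (η := η) (lev₀ := lev₀) U) (deltaPiCLM L m φ (τc : 𝔸 →ₗ[ℂ] ℂ) U Gp lev₁ (nabla115 η U)) hθ

end Chain

end Summit.QuantumFields.BalabanUV.T4Continuum.NE9CurChartOneInstance

end
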